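import Summits.BirchSwinnertonDyer.BirchSwinnertonDyer.Theorems.PrintCf2RamifiedOffTYZSelmerRankOneMoverSeven
import Summits.BirchSwinnertonDyer.BirchSwinnertonDyer.Theorems.PrintCf2RamifiedOffTYZSelmerRankOneOfFacts
import HarnessLib

/-!
# Crux `PrintCf2.RamifiedOffTYZOfFacts` (stmt-BirchSwinnertonDyer-20509), line `offtyz-v7`, LEAD cycle 9 (cruxlead-20509 g8):
# THE `s = 1` STRATUM FOR `n ≡ 7 (mod 8)` — THE NON-DEGENERACY CONDITION IS «SOME PRIME FACTOR ≡ ±3 (mod 8)»; DISPLAY SHAPE, BY NAME, ISOGENY SATURATION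

THEOREMS ONLY (no `def`, no named fact, no `sorry`), `--supports stmt-BirchSwinnertonDyer-20509` (the `s = 1`, `n ≡ 7 (8)` stratum of item 23432
`RamifiedOffJumpOneOfFacts`; the `n ≡ 7` counterparts of g7's `…SelmerRankOneOfDisplays` (p693978) and `…SelmerRankOneOfFacts` (p694796)).

* `kappaB_ne_zero_or_kappaA_ne_of_exists_mod_eight` — **the non-degeneracy hypothesis of `…SelmerRankOneMoverSeven` is «some `pᵢ ≡ 3, 5 (mod 8)`»**:
  if `#Sel₂(E_n) = 8` (so `ker M_n = {0, κ_n}`) and some `(2/pᵢ) = −1`, then `κB ≠ 0` or `κA` is non-constant — otherwise `κ_n = (𝟙; 0)` and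
  `M_n(𝟙;0) = (z; z) ≠ 0`.  (Conversely, if all `pᵢ ≡ ±1 (mod 8)` then `(𝟙;0) ∈ ker M_n`, the class is `(n; 1)`, `q(κ_n) = 0` and NO square moves
  `P(n)` — those are left to TYZ's genus criterion, which the LEAD's pattern census finds satisfied on every such `s = 1` class with `k ≤ 7` primes.)
* `rankOne_sha_bsdp_two_of_selmerEight_of_displays_seven` — square-free `n ≡ 7 (mod 8)` with a prime factor `≡ 3` or `5 (mod 8)` and
  `#Sel₂(E_n) = 8`, data `D` with `D.Printed` and the body of `CMPointRingClassFrobeniusPrinted D`, TYZ Thm 1.1 ⟹ `ord = rank = 1`, `Ш[2^∞] = 0`,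
  `BSD(E_n, 2)`; `…_of_facts_seven` — BY NAME on `tyz_cmPointRingClassFrobeniusData ∧ thm11_parity_of_scriptL`; `selmerEight_mod_eight_seven_bsdp_two_of_facts`
  — `OfFacts` shape; `bsdp_two_of_isIsogenous_selmerEight_mod_eight_seven` — isogeny saturation with conjuncts 1–3 of 𝔅_ram;
  `rankOne_sha_bsdp_two_of_selmerEight_of_facts_odd` — `n ≡ 5` (g7) and `n ≡ 7` together.
WHAT IS NEW relative to print (crux notes `Lines/offtyz_v7_QForm.md` §6 (6c), `Lines/offtyz_v7_MoverAssembly.md` §6): TYZ Thm 1.2 certifies the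
`n ≡ 7 (mod 8)` classes with `Σ₁(n)` or `Σ₂'(n)` odd; the LEAD's pattern census (instrument `census7.py`, all Legendre patterns `k ≤ 4`, random
`k = 5, 6`) finds the classes reached HERE and missed there to be 6.6 % (`k = 4`), 10 % (`k = 5`), 15 % (`k = 6`) of `{s(n) = 1}`, and NO `s = 1` class
missed by both. BSD is not proved by any of this; no class is closed by this file (conditional results toward item 23432).

References: [cite: TianYuanZhang2017, Thm. 1.1, Thm. 1.2, §3 (Prop. 3.2 (1), Thm. 3.5, Thm. 3.6 (1), Lemma 3.18, proof of Lemma 3.21)];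
[cite: HeathBrown1994SelmerCongruentII, Appendix (Monsky), typescript p. 39 L10–L41]; [cite: Smith2016CongruentDensity, Thm. 1.2, Thm. 2.2 rows 7];
[cite: MilneADT2006, Thm. I.7.3]; [cite: Miller2011LMS, Def. 1.1].
-/

noncomputable section

open scoped Classical

open WeierstrassCurve Matrix Finset Literature.NumberTheory.EllipticCurves Literature.NumberTheory.EllipticCurves.TianYuanZhang2017
  Literature.NumberTheory.EllipticCurves.TianYuanZhang2017.W2
  Literature.NumberTheory.EllipticCurves.HeathBrown1994
  Literature.NumberTheory.EllipticCurves.MonskySelmerParity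
  Literature.NumberTheory.EllipticCurves.Rank1Residual
  Literature.NumberTheory.QuadraticFields.RingClass
  Summit.BirchSwinnertonDyer.PrintCf2.QForm

set_option autoImplicit false

namespace Summit.BirchSwinnertonDyer.PrintCf2.MoverAssembly

/-! ## §1 Non-degeneracy of the Selmer class ⟸ a prime factor `≡ ±3 (mod 8)` -/

section Nondegenerate

variable {k : ℕ} (p : Fin k → ℕ) (hp : ∀ i, (p i).Prime) (hodd : ∀ i, Odd (p i)) (hinj : Function.Injective p)

include hp hodd hinj in
/-- **Non-degeneracy of the Selmer class from one prime `≡ 3, 5 (mod 8)`**: if `#Sel₂(E_n) = 8` (`n = p₁⋯p_k`) and `(2/pᵢ) = −1` for some `i`,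
then `κB ≠ 0` or `κA` is not constant.  Otherwise `κ_n = (𝟙; 0)`, but `M_n (𝟙; 0) = (A𝟙 + z; z) = (z; z)` has the entry `zᵢ = 1`.
[cite: HeathBrown1994SelmerCongruentII, Appendix (Monsky), typescript p. 39 L27–L33] -/
theorem kappaB_ne_zero_or_kappaA_ne_of_exists_mod_eight (h35 : ∃ i, p i % 8 = 3 ∨ p i % 8 = 5)
    (hsel : Nat.card ((congruentNumberCurve (∏ i, p i)).selmerGroup 2) = 8) :
    kappaB p ≠ 0 ∨ ∃ i j, kappaA p i ≠ kappaA p j := by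
  obtain ⟨h0, hM, -⟩ := kappa_spec_of_card_selmer_eight p hp hodd hinj hsel
  by_contra h
  push Not at h
  obtain ⟨hB, hA⟩ := h
  obtain ⟨i₀, hi₀⟩ := h35
  have hz : addLegendreSym 2 (p i₀) = 1 := by
    rw [addLegendreSym_two_of_odd (hodd i₀), if_neg (by omega)]
  -- `κA` is the constant `c`, `κB = 0`
  set c := kappaA p i₀ with hc
  have hAc : kappaA p = c • (1 : Fin k → ZMod 2) := by
    funext j; rw [Pi.smul_apply, Pi.one_apply, smul_eq_mul, mul_one]; exact hA j i₀
  have hi : ((legendreMatrix p + legendreDiagonal p 2) *ᵥ kappaA p + legendreDiagonal p 2 *ᵥ kappaB p) i₀ = 0 := by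
    have h := congr_fun hM (Sum.inl i₀)
    rw [← sumElim_kappaA_kappaB, monskyMatrixOdd, fromBlocks_mulVec, Sum.elim_comp_inl, Sum.elim_comp_inr, Sum.elim_inl,
      Pi.zero_apply] at h
    exact h
  rw [hB, mulVec_zero, add_zero, hAc, mulVec_smul, add_mulVec, legendreMatrix_mulVec_one, zero_add, legendreDiagonal_mulVec_one,
    Pi.smul_apply, hz, smul_eq_mul, mul_one] at hi
  apply h0
  rw [← sumElim_kappaA_kappaB, hB, hAc, hi, zero_smul]
  funext x
  rcases x with j | j <;> rfl

include hp in
/-- A prime factor `≡ 3, 5 (mod 8)` of `n = ∏ pᵢ` is one of the `pᵢ`. [folklore] -/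
theorem exists_index_mod_eight_of_dvd {n : ℕ} (hprod : ∏ i, p i = n)
    (h35 : ∃ q : ℕ, q.Prime ∧ q ∣ n ∧ (q % 8 = 3 ∨ q % 8 = 5)) : ∃ i, p i % 8 = 3 ∨ p i % 8 = 5 := by
  obtain ⟨q, hq, hqn, hq8⟩ := h35
  rw [← hprod] at hqn
  obtain ⟨i, -, hi⟩ := (Prime.dvd_finsetProd_iff hq.prime p).mp hqn
  rw [Nat.prime_dvd_prime_iff_eq hq (hp i)] at hi
  exact ⟨i, by rw [← hi]; exact hq8⟩

end Nondegenerate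

/-! ## §2 From the per-`n` displays (Frobenius package unfolded) -/

/-- **THE `s = 1` STRATUM FOR A SQUARE-FREE `n ≡ 7 (mod 8)` WITH A PRIME FACTOR `≡ ±3 (mod 8)`, display shape.**  For square-free `n ≡ 7 (mod 8)`
with a prime factor `≡ 3` or `5 (mod 8)` and `#Sel⁽²⁾(E_n/ℚ) = 8`, data `D : GenusPointData n` with `D.Printed`, the CM-point / ring-class / Frobenius
package (the body of `CMPointRingClassFrobeniusPrinted D`), and TYZ Thm 1.1: `ord_{s=1} L(E_n,s) = 1`, `rank E_n(ℚ) = 1`, `Ш(E_n)[2^∞] = 0`, `BSD(E_n, 2)`.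
[cite: TianYuanZhang2017, Thm. 1.1 and §3 (Prop. 3.2 (1), Thm. 3.5, Thm. 3.6 (1), Lemma 3.18, proof of Lemma 3.21)]
[cite: HeathBrown1994SelmerCongruentII, Appendix (Monsky), typescript p. 39 L10–L41] [cite: Cox2013, §5.C Lemma 5.19, (5.22), §9.A] [cite: Miller2011LMS, Def. 1.1] -/
theorem rankOne_sha_bsdp_two_of_selmerEight_of_displays_seven {n : ℕ} (hsq : Squarefree n) (h7 : n % 8 = 7)
    (h35 : ∃ q : ℕ, q.Prime ∧ q ∣ n ∧ (q % 8 = 3 ∨ q % 8 = 5))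
    (D : GenusPointData n) (hPr : D.Printed)
    (hCM : ∃ (z : ℕ → APoint D.H) (Φ : ℕ → Finset (D.H ≃ₐ[ℚ] D.H)) (ΓH ΓH' : ℕ → Subgroup (D.H ≃ₐ[ℚ] D.H))
      (σ θ : ℕ → (D.H ≃ₐ[ℚ] D.H)) (c : D.H ≃ₐ[ℚ] D.H)
      (ρ₂ : (d : ℕ) → (D.galK d →* RingClassGroup (GenusField d) 2))
      (ρ₄ : (d : ℕ) → (D.galK d →* RingClassGroup (GenusField d) 4)),
      D.ConjSpec c ∧
      ∀ d ∈ n.divisors,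
        ((d % 8 = 5 ∨ d % 8 = 6) → D.CMBlockSpec d (z d) (Φ d) (ΓH d) (ΓH' d) (σ d) c) ∧
        (d % 8 = 6 → D.ThetaBlockSpec d (z d) (ΓH d) (ΓH' d) (σ d) (θ d)) ∧
        (d % 8 = 7 → D.SevenBlockSpec d) ∧
        (d % 8 = 5 → D.RingClassTwoBlockSpec d (ΓH d) (ΓH' d) (ρ₂ d)) ∧
        (d % 8 = 6 → D.RingClassFourBlockSpec d (ΓH d) (ΓH' d) (ρ₄ d)) ∧
        (d % 8 = 5 → ∀ q : ℕ, q.Prime → q ∣ d → ∃ φ : D.H ≃ₐ[ℚ] D.H,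
          φ (D.sqrtNeg d) = D.sqrtNeg d ∧ φ * φ ∈ ΓH' d ∧ φ D.im = (jacobiSym (-1) q) • D.im ∧
            ∀ r : ℕ, r.Prime → r ∣ n → r ≠ q → φ (D.sqrtNeg r) = (jacobiSym (-(r : ℤ)) q) • D.sqrtNeg r))
    (h11 : thm11_parity_of_scriptL)
    (hsel : haveI := isElliptic_congruentNumberCurve hsq.ne_zero; Nat.card ((congruentNumberCurve n).selmerGroup 2) = 8) :
    haveI := isElliptic_congruentNumberCurve hsq.ne_zero
    (congruentNumberCurve n).analyticRank = 1 ∧ (congruentNumberCurve n).mordellWeilRank = 1 ∧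
      AddCommGroup.primaryComponent (congruentNumberCurve n).sha 2 = ⊥ ∧ BSDp (congruentNumberCurve n) 2 := by
  have hodd : Odd n := Nat.odd_iff.mpr (by omega)
  obtain ⟨k, p, hp, hp2, hinj, hprod⟩ := exists_odd_prime_family_of_squarefree hsq hodd
  have hpodd : ∀ i, Odd (p i) := fun i => (hp i).odd_of_ne_two (hp2 i)
  obtain ⟨z, Φ, ΓH, ΓH', σ, θ, c, ρ₂, ρ₄, hc, hall⟩ := hCM
  obtain ⟨hLs, -, hrec, -, h35M, -, -, -, h318, -, -⟩ := hPr
  have hsel' : Nat.card ((congruentNumberCurve (∏ i, p i)).selmerGroup 2) = 8 := by rw [hprod]; exact hsel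
  have hnd := kappaB_ne_zero_or_kappaA_ne_of_exists_mod_eight p hp hpodd hinj (exists_index_mod_eight_of_dvd p hp hprod h35) hsel'
  exact rankOne_sha_bsdp_two_of_card_selmer_eight_seven p hp hpodd hinj D hprod.symm h7 hrec h35M hLs h318 z Φ ΓH ΓH' σ c ρ₂ hc
    (fun d hd => ⟨(hall d hd).1, (hall d hd).2.2.1⟩) (fun d hd h5d => (hall d hd).2.2.2.1 h5d)
    (fun d hd h5d => (hall d hd).2.2.2.2.2 h5d) h11 hnd hsel

/-! ## §3 By name on the two printed facts -/

/-- **THE MINIMAL-SELMER CASE AT `p = 2` FOR `n ≡ 7 (mod 8)` WITH A PRIME FACTOR `≡ ±3 (mod 8)`, from the named facts.**  Granted Tian–Yuan–Zhang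
2017 §3 as printed with the Frobenius elements of the ramified primes (`tyz_cmPointRingClassFrobeniusData`) and TYZ Thm 1.1 (`thm11_parity_of_scriptL`):
for every square-free `n ≡ 7 (mod 8)` with a prime factor `≡ 3` or `5 (mod 8)` and `#Sel⁽²⁾(E_n/ℚ) = 8`: `ord_{s=1} L(E_n, s) = 1`, `rank E_n(ℚ) = 1`,
`Ш(E_n/ℚ)[2^∞] = 0` and `BSD(E_n, 2)`.
[cite: TianYuanZhang2017, Thm. 1.1 and §3 (Prop. 3.2 (1), Thm. 3.5, Thm. 3.6 (1), Lemma 3.18, proof of Lemma 3.21)]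
[cite: HeathBrown1994SelmerCongruentII, Appendix (Monsky), typescript p. 39 L10–L41] [cite: Smith2016CongruentDensity, Thm. 1.2] [cite: Miller2011LMS, Def. 1.1] -/
theorem rankOne_sha_bsdp_two_of_selmerEight_of_facts_seven (hF : tyz_cmPointRingClassFrobeniusData) (h11 : thm11_parity_of_scriptL)
    {n : ℕ} (hsq : Squarefree n) (h7 : n % 8 = 7) (h35 : ∃ q : ℕ, q.Prime ∧ q ∣ n ∧ (q % 8 = 3 ∨ q % 8 = 5))
    (hsel : haveI := isElliptic_congruentNumberCurve hsq.ne_zero; Nat.card ((congruentNumberCurve n).selmerGroup 2) = 8) :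
    haveI := isElliptic_congruentNumberCurve hsq.ne_zero
    (congruentNumberCurve n).analyticRank = 1 ∧ (congruentNumberCurve n).mordellWeilRank = 1 ∧
      AddCommGroup.primaryComponent (congruentNumberCurve n).sha 2 = ⊥ ∧ BSDp (congruentNumberCurve n) 2 := by
  obtain ⟨D, hPr, hCM⟩ := hF n hsq (Or.inr (Or.inr h7))
  exact rankOne_sha_bsdp_two_of_selmerEight_of_displays_seven hsq h7 h35 D hPr hCM h11 hsel

/-- **`OfFacts` shape for the planner** (`n ≡ 7 (mod 8)`): the conjunction of the two printed facts implies, for every square-free `n ≡ 7 (mod 8)`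
with a prime factor `≡ 3, 5 (mod 8)` and `#Sel₂(E_n) = 8`, `ord = rank = 1`, `Ш[2^∞] = 0` and BSD(E_n, 2).
[cite: TianYuanZhang2017, Thm. 1.1 and §3] [cite: Miller2011LMS, Def. 1.1] -/
theorem selmerEight_mod_eight_seven_bsdp_two_of_facts :
    (tyz_cmPointRingClassFrobeniusData ∧ thm11_parity_of_scriptL) →
      ∀ n : ℕ, (hsq : Squarefree n) → n % 8 = 7 → (∃ q : ℕ, q.Prime ∧ q ∣ n ∧ (q % 8 = 3 ∨ q % 8 = 5)) →
        (haveI := isElliptic_congruentNumberCurve hsq.ne_zero; Nat.card ((congruentNumberCurve n).selmerGroup 2) = 8) →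
        haveI := isElliptic_congruentNumberCurve hsq.ne_zero
        (congruentNumberCurve n).analyticRank = 1 ∧ (congruentNumberCurve n).mordellWeilRank = 1 ∧
          AddCommGroup.primaryComponent (congruentNumberCurve n).sha 2 = ⊥ ∧ BSDp (congruentNumberCurve n) 2 :=
  fun h _ hsq h7 h35 hsel => rankOne_sha_bsdp_two_of_selmerEight_of_facts_seven h.1 h.2 hsq h7 h35 hsel

/-! ## §4 Isogeny saturation from the named facts (conjuncts 1–3 of 𝔅_ram) -/

/-- **`BSD(W, 2)` for every globally minimal `W/ℚ` isogenous to a minimal-Selmer `E_n`, `n ≡ 7 (mod 8)` with a prime factor `≡ ±3 (mod 8)`**,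
granted the two printed TYZ facts and conjuncts 1–3 of the route's bundle 𝔅_ram (GZK, entire `L`, Cassels). [cite: MilneADT2006, Thm. I.7.3]
[cite: TianYuanZhang2017, Thm. 1.1 and §3] [cite: Miller2011LMS, Def. 1.1] -/
theorem bsdp_two_of_isIsogenous_selmerEight_mod_eight_seven (hF : tyz_cmPointRingClassFrobeniusData) (h11 : thm11_parity_of_scriptL)
    (hGZK : rank_eq_analyticRank_of_analyticRank_le_one) (hL : hasEntireLFunction_rat) (hCassels : bsdRHS_eq_of_isIsogenous)
    {W : WeierstrassCurve ℚ} [W.IsElliptic] [W.IsGloballyMinimal]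
    {n : ℕ} (hsq : Squarefree n) (h7 : n % 8 = 7) (h35 : ∃ q : ℕ, q.Prime ∧ q ∣ n ∧ (q % 8 = 3 ∨ q % 8 = 5))
    (hsel : haveI := isElliptic_congruentNumberCurve hsq.ne_zero; Nat.card ((congruentNumberCurve n).selmerGroup 2) = 8)
    (hiso : IsIsogenous W (congruentNumberCurve n)) : BSDp W 2 := by
  haveI := isElliptic_congruentNumberCurve hsq.ne_zero
  haveI := isGloballyMinimal_congruentNumberCurve hsq
  obtain ⟨hr1, -, -, h₀⟩ := rankOne_sha_bsdp_two_of_selmerEight_of_facts_seven hF h11 hsq h7 h35 hsel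
  exact Wuthrich2014.bsdp_of_isIsogenous hCassels hiso (hGZK (congruentNumberCurve n) hr1.le).2
    ((congruentNumberCurve n).leadingLCoeff_ne_zero_holds (hL (congruentNumberCurve n))) h₀

/-- **Both odd residues at once, by name**: for square-free `n` with `#Sel₂(E_n) = 8` and either `n ≡ 5 (mod 8)`, or `n ≡ 7 (mod 8)` with a prime
factor `≡ 3, 5 (mod 8)`: `ord = rank = 1`, `Ш[2^∞] = 0`, `BSD(E_n, 2)` — g7's `n ≡ 5` theorem and this file's `n ≡ 7` theorem together.
[cite: TianYuanZhang2017, Thm. 1.1 and §3] [cite: Miller2011LMS, Def. 1.1] -/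
theorem rankOne_sha_bsdp_two_of_selmerEight_of_facts_odd (hF : tyz_cmPointRingClassFrobeniusData) (h11 : thm11_parity_of_scriptL)
    {n : ℕ} (hsq : Squarefree n)
    (h57 : n % 8 = 5 ∨ (n % 8 = 7 ∧ ∃ q : ℕ, q.Prime ∧ q ∣ n ∧ (q % 8 = 3 ∨ q % 8 = 5)))
    (hsel : haveI := isElliptic_congruentNumberCurve hsq.ne_zero; Nat.card ((congruentNumberCurve n).selmerGroup 2) = 8) :
    haveI := isElliptic_congruentNumberCurve hsq.ne_zero
    (congruentNumberCurve n).analyticRank = 1 ∧ (congruentNumberCurve n).mordellWeilRank = 1 ∧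
      AddCommGroup.primaryComponent (congruentNumberCurve n).sha 2 = ⊥ ∧ BSDp (congruentNumberCurve n) 2 := by
  rcases h57 with h5 | ⟨h7, h35⟩
  · exact rankOne_sha_bsdp_two_of_selmerEight_of_facts hF h11 hsq h5 hsel
  · exact rankOne_sha_bsdp_two_of_selmerEight_of_facts_seven hF h11 hsq h7 h35 hsel

end Summit.BirchSwinnertonDyer.PrintCf2.MoverAssembly

end
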